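import Literature.Computability.Complexity.ExpTimeCollapses
import Literature.Computability.Complexity.ExpClosure
import Literature.Computability.Complexity.MeyerSigmaTwo
import Literature.Computability.Complexity.TableauRowsProofs
import HarnessLib

/-!
# Collapses of exponential time under polynomial-size circuits: proofs (Meyer's theorem)

Sibling proof file of `ExpTimeCollapses.lean` (D-0014: the named facts there stay `def`s; this
file proves theorems about them). It assembles **Meyer's theorem** (Karp–Lipton 1980, §6,
attributed to A. Meyer; Arora–Barak 2009, Thm. 6.20: `EXP ⊆ P/poly ⟹ EXP = Σ₂ᵖ`) over the tree's
classes from the toolkit `TableauRows.lean` → `MeyerVerifier.lean` → `MeyerMatrix.lean` →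
`MeyerSigmaTwo.lean`:

* `SigmaP_two_subset_EXP` — the easy half `Σ₂ᵖ ⊆ EXP` (closure of `EXP` under both polynomially
  bounded quantifiers, `ExpClosure.lean`);
* `EXP_subset_SigmaP_two_of_rowLang` — the hard half `EXP ⊆ Σ₂ᵖ` under `EXP ⊆ P/poly`, from the
  named fact `Tableau.rowLang_mem_EXP` (the row language of every machine is in `EXP` — the clocked
  simulation which Arora–Barak's proof uses when it applies `EXP ⊆ P/poly` to the transcript):
  `RowLang M ∈ EXP ⊆ P/poly = P/poly-advice` (`PPoly_subset_polyAdvice_P`, Thm. 6.18) and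
  `Meyer.mem_SigmaP_two`;
* `EXP_eq_SigmaP_two_of_subset_PPoly_of_rowLang` — Meyer's theorem from the row-language fact
  `Tableau.rowLang_mem_EXP`, and **`EXP_eq_SigmaP_two_of_subset_PPoly_holds`** — the DISCHARGE of
  the named fact `EXP_eq_SigmaP_two_of_subset_PPoly`, feeding in the tree's discharge
  `Tableau.rowLang_mem_EXP_holds` (`TableauRowsProofs.lean`: the clocked simulation of the
  standard machine of `M` on bit-coded configurations, `CfgCodes*.lean`, padded by `lpad`).

## References

* S. Arora, B. Barak, *Computational Complexity: A Modern Approach*, CUP 2009, Thm. 6.20 (p. 114),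
  Thm. 6.18, Claim 2.4.
* R. M. Karp, R. J. Lipton, *Some connections between nonuniform and uniform complexity classes*,
  Proc. 12th STOC (1980) 302–309, §6.
-/

namespace Literature.Computability.Complexity

/-! ### Assembly: Meyer's theorem from the row-language fact -/

section Assembly

open _root_.Computability Turing Polynomial Tableau

/-- **`Σ₂ᵖ ⊆ EXP`** (the easy half of `EXP = Σ₂ᵖ`): `Σ₂ᵖ = ∃ᵖ·∀ᵖ·P ⊆ ∃ᵖ·∀ᵖ·EXP ⊆ EXP` by the
closure of `EXP` under both polynomially bounded quantifiers (`polyExists_EXP_subset_EXP`,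
`polyForall_EXP_subset_EXP`, `ExpClosure.lean`: enumerate all witnesses).
[cite: AroraBarakCC2009, Thm. 6.20] -/
theorem SigmaP_two_subset_EXP : SigmaP 2 ⊆ EXP := by
  intro L hL
  change L ∈ polyExists (polyForall (SigmaP 0)) at hL
  have hmono : polyForall (SigmaP 0) ⊆ polyForall EXP :=
    co_mono (polyExists_mono (co_mono P_subset_EXP))
  exact polyExists_EXP_subset_EXP (polyExists_mono (hmono.trans polyForall_EXP_subset_EXP) hL)

/-- Arithmetic of the width parameters: with `h = q + n + D + 2` (`D = dM M ≥ depth + 1`),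
`n + depth · 2^{q+1} < 2^h`. [folklore] -/
theorem Meyer.widths_far {n q D depth : ℕ} (hD : depth < D) :
    n + depth * 2 ^ (q + 1) < 2 ^ (q + n + D + 2) := by
  have h1 : n < 2 ^ n := Nat.lt_two_pow_self
  have h2 : D < 2 ^ D := Nat.lt_two_pow_self
  have h3 : depth * 2 ^ (q + 1) < 2 ^ D * 2 ^ (q + 1) :=
    Nat.mul_lt_mul_of_pos_right (by omega) (by positivity)
  have h4 : 2 ^ n ≤ 2 ^ (q + n + D + 1) := Nat.pow_le_pow_right (by norm_num) (by omega)
  have h5 : 2 ^ D * 2 ^ (q + 1) ≤ 2 ^ (q + n + D + 1) := by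
    rw [← pow_add]; exact Nat.pow_le_pow_right (by norm_num) (by omega)
  have h6 : 2 ^ (q + n + D + 2) = 2 ^ (q + n + D + 1) + 2 ^ (q + n + D + 1) := by
    rw [pow_succ]; ring
  omega

/-- Arithmetic of the width parameters: `3D < 2^{h+1}` and `D ≤ 2^h` for `h ≥ D + 2`. [folklore] -/
theorem Meyer.widths_small {D h : ℕ} (hh : D + 2 ≤ h) : 3 * D < 2 ^ (h + 1) ∧ D ≤ 2 ^ h := by
  have h2 : D < 2 ^ D := Nat.lt_two_pow_self
  have h3 : 2 ^ D ≤ 2 ^ h := Nat.pow_le_pow_right (by norm_num) (by omega)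
  have h4 : 2 ^ (h + 1) = 2 ^ h + 2 ^ h := by rw [pow_succ]; ring
  have h5 : 2 ^ (D + 2) ≤ 2 ^ h := Nat.pow_le_pow_right (by norm_num) hh
  have h6 : 2 ^ (D + 2) = 4 * 2 ^ D := by rw [pow_add]; ring
  omega

/-- **Meyer's theorem from the row-language fact** (Arora–Barak 2009, Thm. 6.20, the direction
`EXP ⊆ Σ₂ᵖ`): if the row language of every machine is in `EXP` (`Tableau.rowLang_mem_EXP`) and
`EXP ⊆ P/poly`, then `EXP ⊆ Σ₂ᵖ`. For `L ∈ EXP` decided by `M` within `2^{q(n)}` steps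
(`exists_two_pow_eval_of_mem_EXP`): `RowLang M ∈ EXP ⊆ P/poly = P/poly-advice`
(`PPoly_subset_polyAdvice_P`, Thm. 6.18) supplies a polynomial-time advice language deciding the
transcript, and `Meyer.mem_SigmaP_two` (the `∃ advice ∀ local check` sentence) gives `L ∈ Σ₂ᵖ`,
with widths `Q = q(n) + 1`, `R = q(n) + n + d + 3`. [cite: AroraBarakCC2009, Thm. 6.20] -/
theorem EXP_subset_SigmaP_two_of_rowLang (hB : Tableau.rowLang_mem_EXP) (h : EXP ⊆ PPoly) :
    EXP ⊆ SigmaP 2 := by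
  intro L hL
  obtain ⟨qP, M, hM⟩ := exists_two_pow_eval_of_mem_EXP hL
  -- the advice deciding the row language
  obtain ⟨A, hA, adv, pa, hlen, hadv⟩ := PPoly_subset_polyAdvice_P (h (hB M))
  refine Meyer.mem_SigmaP_two M qP (qP + X + Polynomial.C (Tableau.dM M + 2)) hA
    (fun x => hM x) adv pa hlen hadv (fun n => ?_) (fun n => ?_) (fun n => ?_)
  · simp only [eval_add, eval_X, eval_C]
    exact (Meyer.widths_small (D := Tableau.dM M) (h := qP.eval n + n + (Tableau.dM M + 2)) (by omega)).1
  · simp only [eval_add, eval_X, eval_C, ← Nat.add_assoc]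
    exact Meyer.widths_far (Tableau.depth_lt_dM M)
  · simp only [eval_add, eval_X, eval_C]
    exact (Meyer.widths_small (D := Tableau.dM M) (h := qP.eval n + n + (Tableau.dM M + 2)) (by omega)).2

/-- **Meyer's theorem, conditional on the row-language fact**: `Tableau.rowLang_mem_EXP` implies
the named fact `EXP_eq_SigmaP_two_of_subset_PPoly` (`ExpTimeCollapses.lean`; Karp–Lipton 1980,
§6, attributed to A. Meyer; Arora–Barak 2009, Thm. 6.20: `EXP ⊆ P/poly ⟹ EXP = Σ₂ᵖ`).
[cite: AroraBarakCC2009, Thm. 6.20] -/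
theorem EXP_eq_SigmaP_two_of_subset_PPoly_of_rowLang (hB : Tableau.rowLang_mem_EXP) :
    EXP_eq_SigmaP_two_of_subset_PPoly := fun h =>
  Set.Subset.antisymm (EXP_subset_SigmaP_two_of_rowLang hB h) SigmaP_two_subset_EXP

/-- **Meyer's theorem** (Karp–Lipton 1980, §6, attributed to A. Meyer; Arora–Barak 2009, Thm. 6.20,
p. 114: "If `EXP ⊆ P/poly` then `EXP = Σ₂ᵖ`"), over the tree's classes `EXP`, `PPoly`, `SigmaP 2`:
**discharge of the named fact `EXP_eq_SigmaP_two_of_subset_PPoly`** (`ExpTimeCollapses.lean`).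
`⊇` is the closure of `EXP` under polynomially bounded quantifiers (`SigmaP_two_subset_EXP`); `⊆`:
for `L ∈ EXP` decided by `M` in time `2^{q(n)}`, the row language of `M` (the transcript
`(x, i, J) ↦ zᵢ[J]`, `TableauRows.lean`) is in `EXP` (`Tableau.rowLang_mem_EXP_holds`,
`TableauRowsProofs.lean`, the clocked simulation), hence in `P/poly = P/poly-advice`, and `x ∈ L`
iff some advice makes every local
check of the claimed rows pass (`Meyer.mem_SigmaP_two`: completeness by the genuine advice,
soundness because locally consistent rows are the true rows, `Tableau.LocallyConsistent`).
[cite: AroraBarakCC2009, Thm. 6.20] -/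
theorem EXP_eq_SigmaP_two_of_subset_PPoly_holds : EXP_eq_SigmaP_two_of_subset_PPoly :=
  EXP_eq_SigmaP_two_of_subset_PPoly_of_rowLang Tableau.rowLang_mem_EXP_holds

end Assembly

end Literature.Computability.Complexity
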